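import Summits.CriticalPhenomena.PercolationContinuityZ3.Theorems.PercNearOneGluingNoHeavyLowerTailCubicThreePointInduction
import Summits.CriticalPhenomena.PercolationContinuityZ3.Theorems.PercNearOneGluingNoHeavyLowerTailCubicThreePointTerminalClosure
import Mathlib.Algebra.BigOperators.Group.Finset.Powerset
import Mathlib.Algebra.Order.BigOperators.Group.Finset
import Mathlib.Tactic.Ring
import Mathlib.Tactic.Linarith
import Mathlib.Tactic.Positivity
import HarnessLib

/-!
# `NoHeavyLowerTail` (stmt-CriticalPhenomena-4575) — the THREE-COPY FIBRE CRITERION for SHK3⁺ (Sahi's C₃ on the pairwise separations)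

Support file (prover prim-sahi-p2, SAHI cell P2; `--supports stmt-CriticalPhenomena-4575`).  Finitary calculus of `…CubicThreePointSections` /
`…CubicThreePointInduction` (prim-ineq-prove-2): `PrW D p X = Σ_{S ⊆ D} wtW S · 1[S ∈ X]`, cells `evQ, evU₁, evU₂, evU₃, evT` of `(K; a,b,c)`,
`shk3W D p K a b c = F(P(a|b|c), P(ab|c), P(ac|b), P(bc|a), P(abc))` with `F = (σ+t)(qt − e₂) − e₃` (homogeneous cubic).

THE CRITERION.  Expanding the homogeneous cubic `F` trilinearly, `6·shk3W = Σ_{S₁,S₂,S₃ ⊆ D} w(S₁)w(S₂)w(S₃)·Pol6(δ(S₁),δ(S₂),δ(S₃))`, where `δ(S) ∈ {0,1}⁵`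
is the cell indicator vector of the configuration `S` and `Pol6(x,y,z) = F(x+y+z) − F(x+y) − F(x+z) − F(y+z) + F(x) + F(y) + F(z)` is six times the
polar (symmetric trilinear) form of `F` (`tripleSum_eq`).  The weight of a triple depends only on its PROFILE
`data3(S₁,S₂,S₃) = (S₁∪S₂∪S₃, pairwise intersections, S₁∩S₂∩S₃)`, i.e. on `k_e = #{i : e ∈ Sᵢ} ∈ {0,1,2,3}`: it is `W3 = Π_e p_e^{k_e}(1−p_e)^{3−k_e}`
(`wt_triple`).  Regrouping (`regroup`): `6·shk3W = Σ_A W3(A)·Fib(A)` with `Fib(A) = Σ_{data3 = A} Pol6` — the tensor-Bernstein coefficient of multi-degree 3.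
Hence (`shk3W_nonneg_of_fib`): if every fibre sum `Fib(A)` is `≥ 0` (a statement about the GRAPH only, no weights), then SHK3⁺ holds for ALL weights in `[0,1]`.
For verification on a concrete graph the fibre sum is re-expressed (`Fib_eq_fast`) as an INTEGER double sum `FibFast` over `S₁, S₂ ⊆ A₁` (the third copy is
then determined: `mk3`), with the cells read off any table `st` of cell labels that is correct on `D.powerset` (`cellOK`); `shk3W_nonneg_of_fibFast` is the
form a `decide`/`native_decide` certificate discharges (used for the theta graph `K₂,₃ + e` in `…CubicThreePointFibreTheta`).
This is the kernel side of the fibre programme of run/shared/lean/prim/prim-sahi/prim-sahi-p2/PROOF-E3.md §6–§7 (exact certificates: all graphs on ≤ 6 vertices).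
[cite: Gladkov2024StrongFKG, Cor. 4.2 (the cubic row SHK3⁺ ⊇ AG)]; [cite: GladkovZimin2024HK, §4–§5 (multi-copy expansions of polynomial inequalities in connection probabilities)]
-/

namespace Summit.CriticalPhenomena.PercolationContinuityZ3.Theorems

namespace TerminalGluing

open Finset SimpleGraph Literature.Probability.Percolation Literature.Probability.Percolation.DecisionTree
open CubicThreePointStep CubicThreePointTerminal


/-! ### The polar form of `F` -/

section Pol

variable {R : Type*} [CommRing R]

/-- Six times the symmetric trilinear (polar) form of the cubic `F`, at three cell vectors. [folklore] -/
def Pol6 (q₁ a₁ b₁ c₁ t₁ q₂ a₂ b₂ c₂ t₂ q₃ a₃ b₃ c₃ t₃ : R) : R :=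
  F (q₁ + q₂ + q₃) (a₁ + a₂ + a₃) (b₁ + b₂ + b₃) (c₁ + c₂ + c₃) (t₁ + t₂ + t₃)
    - F (q₁ + q₂) (a₁ + a₂) (b₁ + b₂) (c₁ + c₂) (t₁ + t₂) - F (q₁ + q₃) (a₁ + a₃) (b₁ + b₃) (c₁ + c₃) (t₁ + t₃)
    - F (q₂ + q₃) (a₂ + a₃) (b₂ + b₃) (c₂ + c₃) (t₂ + t₃)
    + F q₁ a₁ b₁ c₁ t₁ + F q₂ a₂ b₂ c₂ t₂ + F q₃ a₃ b₃ c₃ t₃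

/-- `∂F/∂q`. [folklore] -/
def dFq (q a b c t : R) : R := AG q a b c t + (q + a + b + c + t + t) * t
/-- `∂F/∂u₁`. [folklore] -/
def dFa (q a b c t : R) : R := AG q a b c t - (q + a + b + c + t + t) * (b + c) - b * c
/-- `∂F/∂u₂`. [folklore] -/
def dFb (q a b c t : R) : R := AG q a b c t - (q + a + b + c + t + t) * (a + c) - a * c
/-- `∂F/∂u₃`. [folklore] -/
def dFc (q a b c t : R) : R := AG q a b c t - (q + a + b + c + t + t) * (a + b) - a * b
/-- `∂F/∂t`. [folklore] -/
def dFt (q a b c t : R) : R := 2 * AG q a b c t + (q + a + b + c + t + t) * q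

/-- `Pol6` is linear in its first slot, with coefficients the polarized partial derivatives. [folklore] -/
theorem Pol6_slot1 (q₁ a₁ b₁ c₁ t₁ q₂ a₂ b₂ c₂ t₂ q₃ a₃ b₃ c₃ t₃ : R) :
    Pol6 q₁ a₁ b₁ c₁ t₁ q₂ a₂ b₂ c₂ t₂ q₃ a₃ b₃ c₃ t₃ =
      q₁ * (dFq (q₂ + q₃) (a₂ + a₃) (b₂ + b₃) (c₂ + c₃) (t₂ + t₃) - dFq q₂ a₂ b₂ c₂ t₂ - dFq q₃ a₃ b₃ c₃ t₃)
      + a₁ * (dFa (q₂ + q₃) (a₂ + a₃) (b₂ + b₃) (c₂ + c₃) (t₂ + t₃) - dFa q₂ a₂ b₂ c₂ t₂ - dFa q₃ a₃ b₃ c₃ t₃)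
      + b₁ * (dFb (q₂ + q₃) (a₂ + a₃) (b₂ + b₃) (c₂ + c₃) (t₂ + t₃) - dFb q₂ a₂ b₂ c₂ t₂ - dFb q₃ a₃ b₃ c₃ t₃)
      + c₁ * (dFc (q₂ + q₃) (a₂ + a₃) (b₂ + b₃) (c₂ + c₃) (t₂ + t₃) - dFc q₂ a₂ b₂ c₂ t₂ - dFc q₃ a₃ b₃ c₃ t₃)
      + t₁ * (dFt (q₂ + q₃) (a₂ + a₃) (b₂ + b₃) (c₂ + c₃) (t₂ + t₃) - dFt q₂ a₂ b₂ c₂ t₂ - dFt q₃ a₃ b₃ c₃ t₃) := by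
  simp only [Pol6, F, dFq, dFa, dFb, dFc, dFt, AG]; ring

/-- `Pol6` is symmetric under exchanging slots 1 and 2. [folklore] -/
theorem Pol6_swap12 (q₁ a₁ b₁ c₁ t₁ q₂ a₂ b₂ c₂ t₂ q₃ a₃ b₃ c₃ t₃ : R) :
    Pol6 q₁ a₁ b₁ c₁ t₁ q₂ a₂ b₂ c₂ t₂ q₃ a₃ b₃ c₃ t₃ = Pol6 q₂ a₂ b₂ c₂ t₂ q₁ a₁ b₁ c₁ t₁ q₃ a₃ b₃ c₃ t₃ := by
  simp only [Pol6, F]; ring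

/-- `Pol6` is symmetric under exchanging slots 1 and 3. [folklore] -/
theorem Pol6_swap13 (q₁ a₁ b₁ c₁ t₁ q₂ a₂ b₂ c₂ t₂ q₃ a₃ b₃ c₃ t₃ : R) :
    Pol6 q₁ a₁ b₁ c₁ t₁ q₂ a₂ b₂ c₂ t₂ q₃ a₃ b₃ c₃ t₃ = Pol6 q₃ a₃ b₃ c₃ t₃ q₂ a₂ b₂ c₂ t₂ q₁ a₁ b₁ c₁ t₁ := by
  simp only [Pol6, F]; ring

/-- On the diagonal `Pol6(x,x,x) = F(3x) − 3F(2x) + 3F(x) = 6F(x)` (homogeneity). [folklore] -/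
theorem Pol6_diag (q a b c t : R) : Pol6 q a b c t q a b c t q a b c t = 6 * F q a b c t := by
  simp only [Pol6, F]; ring

end Pol

/-! ### Summing a weighted family through one slot -/

section Linear

variable {α : Type*}

/-- A weighted sum of a 5-term linear expression. [folklore] -/
theorem sum_linear5 (P : Finset α) (w f₁ f₂ f₃ f₄ f₅ : α → ℝ) (A₁ A₂ A₃ A₄ A₅ : ℝ) :
    ∑ x ∈ P, w x * (f₁ x * A₁ + f₂ x * A₂ + f₃ x * A₃ + f₄ x * A₄ + f₅ x * A₅) =
      (∑ x ∈ P, w x * f₁ x) * A₁ + (∑ x ∈ P, w x * f₂ x) * A₂ + (∑ x ∈ P, w x * f₃ x) * A₃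
        + (∑ x ∈ P, w x * f₄ x) * A₄ + (∑ x ∈ P, w x * f₅ x) * A₅ := by
  simp only [Finset.sum_mul, ← Finset.sum_add_distrib]
  exact Finset.sum_congr rfl fun x _ => by ring

/-- `Pol6` commutes with weighted sums in slot 1. [folklore] -/
theorem sum_Pol6_slot1 (P : Finset α) (w f₁ f₂ f₃ f₄ f₅ : α → ℝ) (q₂ a₂ b₂ c₂ t₂ q₃ a₃ b₃ c₃ t₃ : ℝ) :
    ∑ x ∈ P, w x * Pol6 (f₁ x) (f₂ x) (f₃ x) (f₄ x) (f₅ x) q₂ a₂ b₂ c₂ t₂ q₃ a₃ b₃ c₃ t₃ =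
      Pol6 (∑ x ∈ P, w x * f₁ x) (∑ x ∈ P, w x * f₂ x) (∑ x ∈ P, w x * f₃ x) (∑ x ∈ P, w x * f₄ x)
        (∑ x ∈ P, w x * f₅ x) q₂ a₂ b₂ c₂ t₂ q₃ a₃ b₃ c₃ t₃ := by
  rw [Finset.sum_congr rfl (fun x _ => by rw [Pol6_slot1])]
  conv_rhs => rw [Pol6_slot1]
  exact sum_linear5 P w f₁ f₂ f₃ f₄ f₅ _ _ _ _ _

/-- `Pol6` commutes with weighted sums in slot 2. [folklore] -/
theorem sum_Pol6_slot2 (P : Finset α) (w f₁ f₂ f₃ f₄ f₅ : α → ℝ) (q₁ a₁ b₁ c₁ t₁ q₃ a₃ b₃ c₃ t₃ : ℝ) :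
    ∑ x ∈ P, w x * Pol6 q₁ a₁ b₁ c₁ t₁ (f₁ x) (f₂ x) (f₃ x) (f₄ x) (f₅ x) q₃ a₃ b₃ c₃ t₃ =
      Pol6 q₁ a₁ b₁ c₁ t₁ (∑ x ∈ P, w x * f₁ x) (∑ x ∈ P, w x * f₂ x) (∑ x ∈ P, w x * f₃ x) (∑ x ∈ P, w x * f₄ x)
        (∑ x ∈ P, w x * f₅ x) q₃ a₃ b₃ c₃ t₃ := by
  rw [Finset.sum_congr rfl (fun x _ => by rw [Pol6_swap12])]
  conv_rhs => rw [Pol6_swap12]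
  exact sum_Pol6_slot1 P w f₁ f₂ f₃ f₄ f₅ _ _ _ _ _ _ _ _ _ _

/-- `Pol6` commutes with weighted sums in slot 3. [folklore] -/
theorem sum_Pol6_slot3 (P : Finset α) (w f₁ f₂ f₃ f₄ f₅ : α → ℝ) (q₁ a₁ b₁ c₁ t₁ q₂ a₂ b₂ c₂ t₂ : ℝ) :
    ∑ x ∈ P, w x * Pol6 q₁ a₁ b₁ c₁ t₁ q₂ a₂ b₂ c₂ t₂ (f₁ x) (f₂ x) (f₃ x) (f₄ x) (f₅ x) =
      Pol6 q₁ a₁ b₁ c₁ t₁ q₂ a₂ b₂ c₂ t₂ (∑ x ∈ P, w x * f₁ x) (∑ x ∈ P, w x * f₂ x) (∑ x ∈ P, w x * f₃ x)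
        (∑ x ∈ P, w x * f₄ x) (∑ x ∈ P, w x * f₅ x) := by
  rw [Finset.sum_congr rfl (fun x _ => by rw [Pol6_swap13])]
  conv_rhs => rw [Pol6_swap13]
  exact sum_Pol6_slot1 P w f₁ f₂ f₃ f₄ f₅ _ _ _ _ _ _ _ _ _ _

end Linear

variable {V : Type*} [DecidableEq V]

/-! ### The triple-sum (three independent copies) expansion of `6·shk3W` -/

section Triple

variable (D : Finset (Sym2 V)) (p : Sym2 V → ℝ) (K : Finset (Sym2 V)) (a b c : V)

/-- `Pol6` at the cell indicator vectors of three configurations. [folklore] -/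
noncomputable def polInd (S₁ S₂ S₃ : Finset (Sym2 V)) : ℝ :=
  Pol6 (ind (evQ K a b c) S₁) (ind (evU₁ K a b c) S₁) (ind (evU₂ K a b c) S₁) (ind (evU₃ K a b c) S₁) (ind (evT K a b c) S₁)
    (ind (evQ K a b c) S₂) (ind (evU₁ K a b c) S₂) (ind (evU₂ K a b c) S₂) (ind (evU₃ K a b c) S₂) (ind (evT K a b c) S₂)
    (ind (evQ K a b c) S₃) (ind (evU₁ K a b c) S₃) (ind (evU₂ K a b c) S₃) (ind (evU₃ K a b c) S₃) (ind (evT K a b c) S₃)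

/-- **Three-copy expansion**: `Σ_{S₁,S₂,S₃ ⊆ D} w(S₁)w(S₂)w(S₃)·Pol6(δS₁,δS₂,δS₃) = 6·shk3W` (trilinearity + homogeneity of `F`). [folklore] -/
theorem tripleSum_eq :
    ∑ S₁ ∈ D.powerset, ∑ S₂ ∈ D.powerset, ∑ S₃ ∈ D.powerset,
        wtW D p S₁ * wtW D p S₂ * wtW D p S₃ * polInd K a b c S₁ S₂ S₃ = 6 * shk3W D p K a b c := by
  have h3 : ∀ S₁ S₂ : Finset (Sym2 V), ∑ S₃ ∈ D.powerset, wtW D p S₁ * wtW D p S₂ * wtW D p S₃ * polInd K a b c S₁ S₂ S₃ =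
      wtW D p S₁ * wtW D p S₂ * Pol6
        (ind (evQ K a b c) S₁) (ind (evU₁ K a b c) S₁) (ind (evU₂ K a b c) S₁) (ind (evU₃ K a b c) S₁) (ind (evT K a b c) S₁)
        (ind (evQ K a b c) S₂) (ind (evU₁ K a b c) S₂) (ind (evU₂ K a b c) S₂) (ind (evU₃ K a b c) S₂) (ind (evT K a b c) S₂)
        (PrW D p (evQ K a b c)) (PrW D p (evU₁ K a b c)) (PrW D p (evU₂ K a b c)) (PrW D p (evU₃ K a b c))
        (PrW D p (evT K a b c)) := by
    intro S₁ S₂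
    have hre : ∀ S₃ ∈ D.powerset, wtW D p S₁ * wtW D p S₂ * wtW D p S₃ * polInd K a b c S₁ S₂ S₃ =
        wtW D p S₁ * wtW D p S₂ * (wtW D p S₃ * polInd K a b c S₁ S₂ S₃) := fun S₃ _ => by ring
    rw [Finset.sum_congr rfl hre, ← Finset.mul_sum]
    simp only [polInd]
    rw [sum_Pol6_slot3, ← PrW_eq_sum_ind, ← PrW_eq_sum_ind, ← PrW_eq_sum_ind, ← PrW_eq_sum_ind, ← PrW_eq_sum_ind]
  have h2 : ∀ S₁ : Finset (Sym2 V), ∑ S₂ ∈ D.powerset, ∑ S₃ ∈ D.powerset,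
      wtW D p S₁ * wtW D p S₂ * wtW D p S₃ * polInd K a b c S₁ S₂ S₃ =
      wtW D p S₁ * Pol6
        (ind (evQ K a b c) S₁) (ind (evU₁ K a b c) S₁) (ind (evU₂ K a b c) S₁) (ind (evU₃ K a b c) S₁) (ind (evT K a b c) S₁)
        (PrW D p (evQ K a b c)) (PrW D p (evU₁ K a b c)) (PrW D p (evU₂ K a b c)) (PrW D p (evU₃ K a b c))
        (PrW D p (evT K a b c))
        (PrW D p (evQ K a b c)) (PrW D p (evU₁ K a b c)) (PrW D p (evU₂ K a b c)) (PrW D p (evU₃ K a b c))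
        (PrW D p (evT K a b c)) := by
    intro S₁
    rw [Finset.sum_congr rfl (fun S₂ _ => h3 S₁ S₂)]
    have hre : ∀ S₂ ∈ D.powerset, wtW D p S₁ * wtW D p S₂ * Pol6
        (ind (evQ K a b c) S₁) (ind (evU₁ K a b c) S₁) (ind (evU₂ K a b c) S₁) (ind (evU₃ K a b c) S₁) (ind (evT K a b c) S₁)
        (ind (evQ K a b c) S₂) (ind (evU₁ K a b c) S₂) (ind (evU₂ K a b c) S₂) (ind (evU₃ K a b c) S₂) (ind (evT K a b c) S₂)
        (PrW D p (evQ K a b c)) (PrW D p (evU₁ K a b c)) (PrW D p (evU₂ K a b c)) (PrW D p (evU₃ K a b c))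
        (PrW D p (evT K a b c)) =
        wtW D p S₁ * (wtW D p S₂ * Pol6
        (ind (evQ K a b c) S₁) (ind (evU₁ K a b c) S₁) (ind (evU₂ K a b c) S₁) (ind (evU₃ K a b c) S₁) (ind (evT K a b c) S₁)
        (ind (evQ K a b c) S₂) (ind (evU₁ K a b c) S₂) (ind (evU₂ K a b c) S₂) (ind (evU₃ K a b c) S₂) (ind (evT K a b c) S₂)
        (PrW D p (evQ K a b c)) (PrW D p (evU₁ K a b c)) (PrW D p (evU₂ K a b c)) (PrW D p (evU₃ K a b c))
        (PrW D p (evT K a b c))) := fun S₂ _ => by ring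
    rw [Finset.sum_congr rfl hre, ← Finset.mul_sum, sum_Pol6_slot2, ← PrW_eq_sum_ind, ← PrW_eq_sum_ind, ← PrW_eq_sum_ind,
      ← PrW_eq_sum_ind, ← PrW_eq_sum_ind]
  rw [Finset.sum_congr rfl (fun S₁ _ => h2 S₁), sum_Pol6_slot1, ← PrW_eq_sum_ind, ← PrW_eq_sum_ind, ← PrW_eq_sum_ind,
    ← PrW_eq_sum_ind, ← PrW_eq_sum_ind, Pol6_diag, shk3W]

end Triple

/-! ### Regrouping by the profile of the triple -/

section Regroup

variable (D : Finset (Sym2 V)) (p : Sym2 V → ℝ) (K : Finset (Sym2 V)) (a b c : V)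

/-- The profile of a triple of configurations: (union, set of edges in ≥ 2 copies, triple intersection). [folklore] -/
def data3 (S₁ S₂ S₃ : Finset (Sym2 V)) : Finset (Sym2 V) × Finset (Sym2 V) × Finset (Sym2 V) :=
  (S₁ ∪ S₂ ∪ S₃, S₁ ∩ S₂ ∪ S₁ ∩ S₃ ∪ S₂ ∩ S₃, S₁ ∩ S₂ ∩ S₃)

/-- The Bernstein weight of a profile: `Π_e p_e^{k_e}(1−p_e)^{3−k_e}`. [folklore] -/
noncomputable def W3 (A : Finset (Sym2 V) × Finset (Sym2 V) × Finset (Sym2 V)) : ℝ :=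
  ∏ e ∈ D, (if e ∈ A.2.2 then p e ^ 3 else if e ∈ A.2.1 then p e ^ 2 * (1 - p e)
    else if e ∈ A.1 then p e * (1 - p e) ^ 2 else (1 - p e) ^ 3)

/-- The weight of a triple is the Bernstein weight of its profile. [folklore] -/
theorem wt_triple (S₁ S₂ S₃ : Finset (Sym2 V)) :
    wtW D p S₁ * wtW D p S₂ * wtW D p S₃ = W3 D p (data3 S₁ S₂ S₃) := by
  unfold wtW W3 data3
  rw [← Finset.prod_mul_distrib, ← Finset.prod_mul_distrib]
  refine Finset.prod_congr rfl fun e _ => ?_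
  dsimp only
  split_ifs <;> first | ring1 | (exfalso; simp_all)

/-- The Bernstein weight of a profile is nonnegative for weights in `[0,1]`. [folklore] -/
theorem W3_nonneg (hp0 : ∀ e, 0 ≤ p e) (hp1 : ∀ e, p e ≤ 1) (A : Finset (Sym2 V) × Finset (Sym2 V) × Finset (Sym2 V)) :
    0 ≤ W3 D p A := by
  unfold W3
  refine Finset.prod_nonneg fun e _ => ?_
  have h0 := hp0 e; have h1 : 0 ≤ 1 - p e := by linarith [hp1 e]
  split_ifs <;> positivity

/-- The fibre sum of a profile `A`: `Σ_{(S₁,S₂,S₃) : data3 = A} Pol6(δS₁,δS₂,δS₃)` (`3^m` times the tensor-Bernstein coefficient of `6·shk3W`). [folklore] -/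
noncomputable def Fib (A : Finset (Sym2 V) × Finset (Sym2 V) × Finset (Sym2 V)) : ℝ :=
  ∑ S₁ ∈ D.powerset, ∑ S₂ ∈ D.powerset, ∑ S₃ ∈ D.powerset, if data3 S₁ S₂ S₃ = A then polInd K a b c S₁ S₂ S₃ else 0

/-- **Regrouping by profile**: `Σ_A W3(A)·Fib(A) = Σ_{S₁,S₂,S₃} w w w · Pol6`. [folklore] -/
theorem regroup :
    ∑ A ∈ D.powerset ×ˢ (D.powerset ×ˢ D.powerset), W3 D p A * Fib D K a b c A =
      ∑ S₁ ∈ D.powerset, ∑ S₂ ∈ D.powerset, ∑ S₃ ∈ D.powerset,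
        wtW D p S₁ * wtW D p S₂ * wtW D p S₃ * polInd K a b c S₁ S₂ S₃ := by
  simp only [Fib, Finset.mul_sum]
  rw [Finset.sum_comm]
  refine Finset.sum_congr rfl fun S₁ hS₁ => ?_
  rw [Finset.sum_comm]
  refine Finset.sum_congr rfl fun S₂ hS₂ => ?_
  rw [Finset.sum_comm]
  refine Finset.sum_congr rfl fun S₃ hS₃ => ?_
  simp only [mul_ite, mul_zero]
  have hflip : ∀ A ∈ D.powerset ×ˢ (D.powerset ×ˢ D.powerset),
      (if data3 S₁ S₂ S₃ = A then W3 D p A * polInd K a b c S₁ S₂ S₃ else 0) =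
      (if data3 S₁ S₂ S₃ = A then W3 D p (data3 S₁ S₂ S₃) * polInd K a b c S₁ S₂ S₃ else 0) := by
    intro A _; split_ifs with h
    · rw [h]
    · rfl
  rw [Finset.sum_congr rfl hflip, Finset.sum_ite_eq]
  have hmem : data3 S₁ S₂ S₃ ∈ D.powerset ×ˢ (D.powerset ×ˢ D.powerset) := by
    rw [Finset.mem_powerset] at hS₁ hS₂ hS₃
    dsimp only [data3]
    simp only [Finset.mem_product, Finset.mem_powerset]
    refine ⟨?_, ?_, ?_⟩
    · exact Finset.union_subset (Finset.union_subset hS₁ hS₂) hS₃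
    · exact Finset.union_subset (Finset.union_subset ((Finset.inter_subset_left).trans hS₁)
        ((Finset.inter_subset_left).trans hS₁)) ((Finset.inter_subset_left).trans hS₂)
    · exact (Finset.inter_subset_left.trans Finset.inter_subset_left).trans hS₁
  rw [if_pos hmem, wt_triple]

/-- **Fibre criterion.**  If every fibre sum is nonnegative (a weight-free statement about the graph `(D, K; a, b, c)`), then
`SHK3⁺ = F(law) ≥ 0` for ALL edge weights in `[0,1]`. [folklore] -/
theorem shk3W_nonneg_of_fib (hp0 : ∀ e, 0 ≤ p e) (hp1 : ∀ e, p e ≤ 1)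
    (hFib : ∀ A ∈ D.powerset ×ˢ (D.powerset ×ˢ D.powerset), 0 ≤ Fib D K a b c A) :
    0 ≤ shk3W D p K a b c := by
  have h6 : 6 * shk3W D p K a b c = ∑ A ∈ D.powerset ×ˢ (D.powerset ×ˢ D.powerset), W3 D p A * Fib D K a b c A := by
    rw [regroup, tripleSum_eq]
  have hs : 0 ≤ ∑ A ∈ D.powerset ×ˢ (D.powerset ×ˢ D.powerset), W3 D p A * Fib D K a b c A :=
    Finset.sum_nonneg fun A hA => mul_nonneg (W3_nonneg D p hp0 hp1 A) (hFib A hA)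
  linarith

end Regroup

end TerminalGluing

end Summit.CriticalPhenomena.PercolationContinuityZ3.Theorems
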